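import Summits.QuantumFields.YangMills.Theorems.UnitScaleTiltProp7SymAvgTwBridge
import Summits.QuantumFields.YangMills.Theorems.UnitScaleTiltProp7QSymGaugeCovariance
import HarnessLib

/-!
# `UnitScaleTiltProp7SymAvgTwGaugeDir` — ON TANGENTS OF PRINT'S AXIAL SLICE THE TWISTED AND THE SYMMETRIC LINEARISED AVERAGES AGREE, hence **`QTw U₀ (D_{U₀}λ) = D_{Ū₀}(λ↓)`** for every
# gauge direction `λ` whose gauge curve `U₀♭^{e^{tλ}}` stays in Ax_k(U₀) (the covariantly-constant `λ` along the combs) — the content of the hypothesis `hΓ` of the twisted right inverse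
# `H^{tw} = H^{sym} + Γ∘r∘H^{sym}` (`Prop7SymAvgTwRightInverse`, RULING g26-№1 (2)∕(3e)) at `Γ := D_{U₀} ∘ ȟ`, reduced to ONE displayed row (the covariantly-constant extension `ȟ`)
# (route `UnitScaleTilt`, crux K1 «MinimiserStabilityRegPr» stmt-QuantumFields-19200, stub `stub_existenceMinimalOrbit` (EX), route (α), (AVG-SYM); OWNER RULING g26-№1 Σ-TWIST (T), item (3d);
# def-free, count-neutral)

Cell `ym3-torus` (HUMAN RULING D-0037, YM ladder rung R3 — YM₃ on T³ is a rung, not d = 4, not a mass gap, not Clay), width seat `ym-ust-20520-w5` (gen 3).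

THE PRINT.  [Balaban1985Averaging] p. 28: «A^λ_b = A_b − (R_{0,b}λ(b₊) − λ(b₋)) = A_b − (D_{V₀}λ)(b). Under such a transformation the average Q₀A changes as follows: (Q₀A^λ)(c) = (Q′₀λ)(c₋) + (Q₀A)(c) − …»;
(87)–(92) p. 31 (the double-bar average; `u = (\overline{R_{0,·}U₁})⁻¹`).  [Balaban1985RegularSpaces] (1.19) p. 79 (the axial gauge Ax_k(U₀)).  [Balaban1985BackgroundPropagators] (3.14),
(3.19) p. 393.

WHAT IS PROVED (sorry-free, no definition; hypotheses `hG`, `hr` = the two differentiability rows of `Prop7SymAvgTwBridge` (displayed, suppliers named there); `hAx` = «for `t` near `0` the pullback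
of `U₀♭^{e^{tλ}}` is in `InAx` relative to `U₀♭`» (displayed: holds for `λ` covariantly constant along the combs from the centres — the row «`ȟ`»)):
* §1 `hasFDerivAt_logChartSym` (`HasFDerivAt (logChartSym U₀) G′ 0` from `hG`).
* §2 ★★★**`QTw_gaugeDir_eq_QSym_of_inAx`** — `QTw U₀ (D_{U₀}λ) = QSym U₀ (D_{U₀}λ)` (both charts agree along the gauge curve by `Prop7SymAvgTwFrameAxial.logChartTw_eq_logChartSym_of_inAx` +
  `Prop7QSymGaugeCovariance.expUnit_chartCurve_eventually`; chain rule; uniqueness of the derivative); ★★★**`QTw_gaugeDir_of_inAx`** — `QTw U₀ (D_{U₀}λ) = (c ↦ λ(x̂c₋) − Ū₀(c)λ(x̂c₊)Ū₀(c)⁻¹)`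
  (∘ `Prop7QSymGaugeCovariance.QSym_gaugeDir`) = the `hΓ` row of `Prop7SymAvgTwRightInverse.exists_rightInv_QTw_of_gaugeLift` at `Γη := D_{U₀}ȟ(η)`, `λ = ȟ(η)`, `ȟ(η)(x̂y) = η(y)`.
HONEST FRAMING.  One-variable calculus over landed identities; `hG`, `hr`, `hAx` displayed; nothing of print is asserted.  `--supports stmt-QuantumFields-19200 --as helper`.

References: T. Bałaban, CMP 98 (1985) 17–51 [Balaban1985Averaging] ((11) p.19, p.28, (87)–(92) p.31); CMP 99 (1985) 75–102 [Balaban1985RegularSpaces] ((1.19) p.79, p.80); CMP 99 (1985) 389–434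
[Balaban1985BackgroundPropagators] ((3.14), (3.19) p.393); CMP 102 (1985) 277–309 [Balaban1985Variational] ((44)–(46) p.285).
-/

set_option autoImplicit false

noncomputable section

open scoped Matrix.Norms.L2Operator Topology

namespace Summit.QuantumFields.YangMills.Theorems.Prop7SymAvgTwGaugeDir

open NormedSpace Filter
open Literature.MathematicalPhysics.QuantumFieldTheory.Balaban1983to89
open Literature.MathematicalPhysics.QuantumFieldTheory.Balaban1983to89.T3ContinuumYM3Torus
open T3LevelShift (siteShift)
open T3PrintedRegularOrbits (sites_eq)
open T3SectALandauChart (bgUnits)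
open B15DeterminingSets (embIter)
open B7Prop1Explicit (expUnit val_expUnit)
open B8Eq119TwistedAxial (InAx)
open B8Thm4TorusAt (torusLam)
open B10Eq27TorusAxialLog (pull gaugeActT)
open MatrixLog (mlog mlog_one)
open B7TransferAnalyticMean (hasFDerivAt_mlog_one)
open Summit.QuantumFields.YangMills.Theorems.Prop7SPrint (basePt)
open Summit.QuantumFields.YangMills.Theorems.Prop7SymAvgGL (descendToGL logChartSym QSym)
open Summit.QuantumFields.YangMills.Theorems.Prop7SymAvgTw (frameTw logChartTw QTw)
open Summit.QuantumFields.YangMills.Theorems.Prop7SymAvgTwFrameAxial (logChartTw_eq_logChartSym_of_inAx)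
open Summit.QuantumFields.YangMills.Theorems.Prop7SymAvgTwBridge (hasFDerivAt_logChartTw rel_zero)
open Summit.QuantumFields.YangMills.Theorems.Prop7QSymGaugeCovariance (QSym_gaugeDir hasDerivAt_mlog_conjCurve conjCurve_zero expUnit_chartCurve_eventually)

variable (F : T3Family) {n K : ℕ} (h : n ≤ K)

/-! ## §1 The log-chart is differentiable at `0` under the bridge hypothesis `hG` -/

/-- `HasFDerivAt (logChartSym U₀) G′ 0` from `hG` (`logChartSym = log ∘ G` coordinatewise, `G(0) = 1`, `log′(1) = id`) — the symmetric half of `Prop7SymAvgTwBridge.hasFDerivAt_logChartTw`.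
[cite: Balaban1985Variational, (44) p.285; Balaban1985Averaging, (21)–(27) p.22] -/
theorem hasFDerivAt_logChartSym (U₀ : GaugeField (F.P K) 0 (Matrix.specialUnitaryGroup (Fin 2) ℂ))
    {G' : (PBond (F.P K) 0 → Matrix (Fin 2) (Fin 2) ℂ) →L[ℂ] (PBond (F.P n) 0 → Matrix (Fin 2) (Fin 2) ℂ)}
    (hG : HasFDerivAt (fun A : PBond (F.P K) 0 → Matrix (Fin 2) (Fin 2) ℂ => fun c : PBond (F.P n) 0 =>
        ((descendToGL F n K h (fun b => expUnit (A b) * bgUnits F K U₀ b) c : (Matrix (Fin 2) (Fin 2) ℂ)ˣ) : Matrix (Fin 2) (Fin 2) ℂ)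
          * (((descendToGL F n K h (bgUnits F K U₀) c)⁻¹ : (Matrix (Fin 2) (Fin 2) ℂ)ˣ) : Matrix (Fin 2) (Fin 2) ℂ)) G' 0) :
    HasFDerivAt (logChartSym F n K h U₀) G' 0 := by
  apply hasFDerivAt_pi''
  intro c
  have hGc : HasFDerivAt (fun A : PBond (F.P K) 0 → Matrix (Fin 2) (Fin 2) ℂ =>
      ((descendToGL F n K h (fun b => expUnit (A b) * bgUnits F K U₀ b) c : (Matrix (Fin 2) (Fin 2) ℂ)ˣ) : Matrix (Fin 2) (Fin 2) ℂ)
        * (((descendToGL F n K h (bgUnits F K U₀) c)⁻¹ : (Matrix (Fin 2) (Fin 2) ℂ)ˣ) : Matrix (Fin 2) (Fin 2) ℂ))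
      ((ContinuousLinearMap.proj c).comp G') 0 := (hasFDerivAt_pi'.1 hG) c
  have hmlog : HasFDerivAt (mlog : Matrix (Fin 2) (Fin 2) ℂ → Matrix (Fin 2) (Fin 2) ℂ) (1 : Matrix (Fin 2) (Fin 2) ℂ →L[ℂ] Matrix (Fin 2) (Fin 2) ℂ)
      (((descendToGL F n K h (fun b => expUnit ((0 : PBond (F.P K) 0 → Matrix (Fin 2) (Fin 2) ℂ) b) * bgUnits F K U₀ b) c : (Matrix (Fin 2) (Fin 2) ℂ)ˣ) :
          Matrix (Fin 2) (Fin 2) ℂ)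
        * (((descendToGL F n K h (bgUnits F K U₀) c)⁻¹ : (Matrix (Fin 2) (Fin 2) ℂ)ˣ) : Matrix (Fin 2) (Fin 2) ℂ)) := by
    rw [rel_zero]; exact hasFDerivAt_mlog_one
  have hcomp := hmlog.comp 0 hGc
  rw [ContinuousLinearMap.one_def, ContinuousLinearMap.id_comp] at hcomp
  exact hcomp

/-! ## §2 On tangents of the axial slice the twisted and the untwisted linearisations agree -/

/-- ★★★ **`QTw U₀ (D_{U₀}λ) = QSym U₀ (D_{U₀}λ)` FOR GAUGE DIRECTIONS TANGENT TO THE AXIAL SLICE**: if the gauge curve `U₀♭^{e^{tλ}}` stays in print's axial gauge Ax_k(U₀) for `t` near `0` (based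
(1.19) on the pullbacks — the case of a COVARIANTLY-CONSTANT `λ` along the combs), then the twisted and the symmetric linearised averages of the fine gauge direction
`(D_{U₀}λ)(b) = λ(b₋) − U₀(b)λ(b₊)U₀(b)⁻¹` coincide — both charts agree along the curve (`Prop7SymAvgTwFrameAxial.logChartTw_eq_logChartSym_of_inAx`), so their derivatives at `t = 0` agree
(chain rule under the bridge hypotheses `hG`, `hr`; uniqueness of the derivative). [cite: Balaban1985Averaging, (87)–(92) p.31, p.28; Balaban1985RegularSpaces, (1.19) p.79; Balaban1985BackgroundPropagators, (3.14) p.393] -/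
theorem QTw_gaugeDir_eq_QSym_of_inAx (U₀ : GaugeField (F.P K) 0 (Matrix.specialUnitaryGroup (Fin 2) ℂ))
    {G' : (PBond (F.P K) 0 → Matrix (Fin 2) (Fin 2) ℂ) →L[ℂ] (PBond (F.P n) 0 → Matrix (Fin 2) (Fin 2) ℂ)}
    (hG : HasFDerivAt (fun A : PBond (F.P K) 0 → Matrix (Fin 2) (Fin 2) ℂ => fun c : PBond (F.P n) 0 =>
        ((descendToGL F n K h (fun b => expUnit (A b) * bgUnits F K U₀ b) c : (Matrix (Fin 2) (Fin 2) ℂ)ˣ) : Matrix (Fin 2) (Fin 2) ℂ)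
          * (((descendToGL F n K h (bgUnits F K U₀) c)⁻¹ : (Matrix (Fin 2) (Fin 2) ℂ)ˣ) : Matrix (Fin 2) (Fin 2) ℂ)) G' 0)
    {r : Site (F.P n) 0 → ((PBond (F.P K) 0 → Matrix (Fin 2) (Fin 2) ℂ) →L[ℂ] Matrix (Fin 2) (Fin 2) ℂ)}
    (hr : ∀ y, HasFDerivAt (fun A : PBond (F.P K) 0 → Matrix (Fin 2) (Fin 2) ℂ => ((frameTw F n K h U₀ A y : (Matrix (Fin 2) (Fin 2) ℂ)ˣ) : Matrix (Fin 2) (Fin 2) ℂ)) (r y) 0)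
    (lam : Site (F.P K) 0 → Matrix (Fin 2) (Fin 2) ℂ)
    (hAx : ∀ᶠ t : ℂ in 𝓝 0, InAx (F.P K).L (K - n) (torusLam (K - n)) (pull (bgUnits F K U₀) (basePt F n K))
      (pull (gaugeActT (fun x => expUnit (t • lam x)) (bgUnits F K U₀)) (basePt F n K))) :
    QTw F n K h U₀ (fun b : PBond (F.P K) 0 =>
        lam b.src - ((bgUnits F K U₀ b : (Matrix (Fin 2) (Fin 2) ℂ)ˣ) : Matrix (Fin 2) (Fin 2) ℂ) * lam b.tgt
          * (((bgUnits F K U₀ b)⁻¹ : (Matrix (Fin 2) (Fin 2) ℂ)ˣ) : Matrix (Fin 2) (Fin 2) ℂ))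
      = QSym F n K h U₀ (fun b : PBond (F.P K) 0 =>
        lam b.src - ((bgUnits F K U₀ b : (Matrix (Fin 2) (Fin 2) ℂ)ˣ) : Matrix (Fin 2) (Fin 2) ℂ) * lam b.tgt
          * (((bgUnits F K U₀ b)⁻¹ : (Matrix (Fin 2) (Fin 2) ℂ)ˣ) : Matrix (Fin 2) (Fin 2) ℂ)) := by
  -- the chart parameter of the gauge curve and its derivative at 0
  set A : ℂ → PBond (F.P K) 0 → Matrix (Fin 2) (Fin 2) ℂ := fun t b =>
    mlog (exp (t • lam b.src) * ((bgUnits F K U₀ b : (Matrix (Fin 2) (Fin 2) ℂ)ˣ) : Matrix (Fin 2) (Fin 2) ℂ) * exp (t • (-lam b.tgt))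
      * (((bgUnits F K U₀ b)⁻¹ : (Matrix (Fin 2) (Fin 2) ℂ)ˣ) : Matrix (Fin 2) (Fin 2) ℂ)) with hA
  have hA0 : A 0 = 0 := by
    funext b
    show mlog (exp ((0 : ℂ) • lam b.src) * _ * exp ((0 : ℂ) • (-lam b.tgt)) * _) = 0
    rw [conjCurve_zero, Units.mul_inv, mlog_one]
  have hA' : HasDerivAt A (fun b : PBond (F.P K) 0 =>
      lam b.src - ((bgUnits F K U₀ b : (Matrix (Fin 2) (Fin 2) ℂ)ˣ) : Matrix (Fin 2) (Fin 2) ℂ) * lam b.tgt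
        * (((bgUnits F K U₀ b)⁻¹ : (Matrix (Fin 2) (Fin 2) ℂ)ˣ) : Matrix (Fin 2) (Fin 2) ℂ)) 0 := by
    rw [hasDerivAt_pi]
    intro b
    exact hasDerivAt_mlog_conjCurve (lam b.src) (lam b.tgt) (bgUnits F K U₀ b)
  -- both charts along the curve
  have hT : HasFDerivAt (logChartTw F n K h U₀) (QTw F n K h U₀) (A 0) := by
    rw [hA0, Prop7SymAvgTw.QTw_def]
    exact (hasFDerivAt_logChartTw F h U₀ hG hr).differentiableAt.hasFDerivAt
  have hS : HasFDerivAt (logChartSym F n K h U₀) (QSym F n K h U₀) (A 0) := by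
    rw [hA0, Summit.QuantumFields.YangMills.Theorems.Prop7SymAvgGL.QSym]
    exact (hasFDerivAt_logChartSym F h U₀ hG).differentiableAt.hasFDerivAt
  have hTc := hT.comp_hasDerivAt (0 : ℂ) hA'
  have hSc := hS.comp_hasDerivAt (0 : ℂ) hA'
  -- they agree near t = 0 (the curve stays on the axial slice)
  have hev : (logChartTw F n K h U₀ ∘ A) =ᶠ[𝓝 0] (logChartSym F n K h U₀ ∘ A) := by
    filter_upwards [expUnit_chartCurve_eventually (F := F) U₀ lam, hAx] with t ht hax
    show logChartTw F n K h U₀ (A t) = logChartSym F n K h U₀ (A t)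
    have hcfg : (fun b => expUnit (A t b) * bgUnits F K U₀ b) = gaugeActT (fun x => expUnit (t • lam x)) (bgUnits F K U₀) := ht
    have hax' : InAx (F.P K).L (K - n) (torusLam (K - n)) (pull (bgUnits F K U₀) (basePt F n K))
        (pull (fun b => expUnit (A t b) * bgUnits F K U₀ b) (basePt F n K)) := by rw [hcfg]; exact hax
    exact logChartTw_eq_logChartSym_of_inAx F h U₀ (A t) hax'
  exact hTc.unique (hSc.congr_of_eventuallyEq hev)

/-- ★★★ **`QTw U₀ (D_{U₀}λ) = D_{Ū₀}(λ↓)` ON THE AXIAL SLICE** — the twisted average of a fine gauge direction tangent to Ax_k(U₀) is the coarse gauge direction of the CENTRE VALUES (§2 ∘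
`Prop7QSymGaugeCovariance.QSym_gaugeDir`).  For `λ = ȟ(η)` (covariantly-constant extension of a coarse `η`, `ȟ(η)(x̂ y) = η(y)`) this is EXACTLY the hypothesis `hΓ` of
`Prop7SymAvgTwRightInverse.exists_rightInv_QTw_of_gaugeLift` at `Γη := D_{U₀}ȟ(η)`; what stays displayed is the row «`ȟ` linear, `ȟ(η)∘x̂ = η`, `U₀♭^{e^{tȟη}} ∈ Ax_k(U₀)`».
[cite: Balaban1985Averaging, (11) p.19, p.28, (87)–(92) p.31; Balaban1985RegularSpaces, (1.19) p.79; Balaban1985BackgroundPropagators, (3.14) p.393, (3.19) p.393] -/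
theorem QTw_gaugeDir_of_inAx (U₀ : GaugeField (F.P K) 0 (Matrix.specialUnitaryGroup (Fin 2) ℂ))
    {G' : (PBond (F.P K) 0 → Matrix (Fin 2) (Fin 2) ℂ) →L[ℂ] (PBond (F.P n) 0 → Matrix (Fin 2) (Fin 2) ℂ)}
    (hG : HasFDerivAt (fun A : PBond (F.P K) 0 → Matrix (Fin 2) (Fin 2) ℂ => fun c : PBond (F.P n) 0 =>
        ((descendToGL F n K h (fun b => expUnit (A b) * bgUnits F K U₀ b) c : (Matrix (Fin 2) (Fin 2) ℂ)ˣ) : Matrix (Fin 2) (Fin 2) ℂ)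
          * (((descendToGL F n K h (bgUnits F K U₀) c)⁻¹ : (Matrix (Fin 2) (Fin 2) ℂ)ˣ) : Matrix (Fin 2) (Fin 2) ℂ)) G' 0)
    {r : Site (F.P n) 0 → ((PBond (F.P K) 0 → Matrix (Fin 2) (Fin 2) ℂ) →L[ℂ] Matrix (Fin 2) (Fin 2) ℂ)}
    (hr : ∀ y, HasFDerivAt (fun A : PBond (F.P K) 0 → Matrix (Fin 2) (Fin 2) ℂ => ((frameTw F n K h U₀ A y : (Matrix (Fin 2) (Fin 2) ℂ)ˣ) : Matrix (Fin 2) (Fin 2) ℂ)) (r y) 0)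
    (lam : Site (F.P K) 0 → Matrix (Fin 2) (Fin 2) ℂ)
    (hAx : ∀ᶠ t : ℂ in 𝓝 0, InAx (F.P K).L (K - n) (torusLam (K - n)) (pull (bgUnits F K U₀) (basePt F n K))
      (pull (gaugeActT (fun x => expUnit (t • lam x)) (bgUnits F K U₀)) (basePt F n K))) :
    QTw F n K h U₀ (fun b : PBond (F.P K) 0 =>
        lam b.src - ((bgUnits F K U₀ b : (Matrix (Fin 2) (Fin 2) ℂ)ˣ) : Matrix (Fin 2) (Fin 2) ℂ) * lam b.tgt
          * (((bgUnits F K U₀ b)⁻¹ : (Matrix (Fin 2) (Fin 2) ℂ)ˣ) : Matrix (Fin 2) (Fin 2) ℂ))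
      = fun c : PBond (F.P n) 0 =>
        lam (embIter (K - n) (siteShift (sites_eq F n K h) c.src))
          - ((descendToGL F n K h (bgUnits F K U₀) c : (Matrix (Fin 2) (Fin 2) ℂ)ˣ) : Matrix (Fin 2) (Fin 2) ℂ) * lam (embIter (K - n) (siteShift (sites_eq F n K h) c.tgt))
            * (((descendToGL F n K h (bgUnits F K U₀) c)⁻¹ : (Matrix (Fin 2) (Fin 2) ℂ)ˣ) : Matrix (Fin 2) (Fin 2) ℂ) := by
  rw [QTw_gaugeDir_eq_QSym_of_inAx F h U₀ hG hr lam hAx]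
  exact QSym_gaugeDir (h := h) U₀ (hasFDerivAt_logChartSym F h U₀ hG).differentiableAt lam

end Summit.QuantumFields.YangMills.Theorems.Prop7SymAvgTwGaugeDir

end
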